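import Summits.QuantumFields.BalabanUV.T4Continuum.Support.ShellMeasureLocalGradientTail
import Summits.QuantumFields.BalabanUV.T4Continuum.Support.ShellMeasureAverageAnalytic

/-!
# `T4Continuum.ShellMeasureWilsonGradientTail` — WALL §2 (a) item (P4), its ONE-GRID FACE (instance): the Wilson
# plaquette functional `A ↦ τ(1 − (e^{iA}U₀)(∂p))` at ANY unit-bounded background is an entire `ExpWord` functional, so
# the bond-localised derivative of the order-≥3 part of the one-grid action `𝒲 = Σ_p τ(1 − (e^{iA}U₀)(∂p))` has the
# (98) SHAPE `Prop4Hyp (tail₂ (locGrad 𝒲)) (32·m·‖τ‖(1 + e^{4R})∕R³) (R∕2)` — constants from the incidence number `m` and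
# `‖τ‖` ONLY, uniform in the background and in the volume (cell `pub-balaban`, sub-cell `t4`, spine estimate NE7c (node
# U5b), owner lineage `b2b-balaban-t4-ne7c-p1` gen 29, table `LEAVES-NE7c-P1.md` row S62 file 2; imports file 1
# `ShellMeasureLocalGradientTail` and the gen-28 engine `ShellMeasureAverageAnalytic` (`ExpWord`); [folklore]; 0 sorry)

HONEST FRAMING.  Finite four-torus programme, rung (B)+1 only — NOT infinite volume, NOT a mass gap, NOT the Clay
problem, NOT summit progress; (B), `BetaPertHyp`, (B^μ) are not consumed.  NE7c (`T4IndicatorShell.ShellWeightBound`)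
is NOT PRINTED and NOT PROVED; «NE7c ⇐ the named binders» (WALL `t4/b2b-balaban-t4-ne7c-p1/WALL-NE7c-P1.md` §2).
Elementary analysis in a complete normed `ℂ`-algebra with `‖1‖ = 1` ([folklore]); nothing printed is asserted or cited
as a fact; no `def … : Prop` (the `def`s are DATA: letters, plaquette words, the plaquette functional, its bond set, the
one-grid action).  HONEST DEPENDENCY (cell): continuum YM on T⁴ ⇐ BetaPertH ∧ nine spine estimates (0/9 proved);
BetaPertH ⇐ (D1) ∧ (D4) ∧ CAP+tail; G-an2-4 gates asym, D1 and NE2/3/4.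

LOCATORS (the paper is under adjudication — ABSOLUTE RULE; renders `b2b-balaban-ref1/pages/1985-cmp102-variational-
background/…`, transcript `HOME/b2b-balaban-b11/transcript.md`).  [Balaban1985Variational] (B11) Sect. B p. 282 (24)–
(26): the action of `U₁U₀`, `U₁ = exp iηA`, expanded in `A` plaquette by plaquette, *«The action A(U₁U₀) is an analytic,
and even an entire function of A for A ∈ 𝔤ᶜ, or for A in the space of all complex N × N matrices, so V₀(A) is such a
function also»*; p. 291 (90): *«((δ∕δA(b))V₀′)(…) = Σ_{p ∈ st(b)} …, where st(b) denotes a set of plaquettes p such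
that b ⊂ ∂p»*; Prop. 4 (97)–(98) pp. 292–293 (quoted in file 1): *«The constants a₃, C₄ depend on d and L only.»*
WHAT IS PROVED (one grid, `η = 1`, sup norms on the bond field `A : Λ → 𝔸`, `Λ` finite):
* §1 `letter`∕`plaqWord`∕`plaqFun`: the oriented letters `(e^{iA(b)}U₀(b))^{±1}`, the four-letter plaquette word, the
  functional `A ↦ τ(1 − U(∂p))` for a continuous linear «trace» `τ : 𝔸 →L[ℂ] ℂ` (the printed «Re tr» is realised by
  pairing a boundary with its reverse — both are members of the family); `expWord_letter` (weight 1, the engine's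
  `ExpWord.expFactor` at the evaluation map), `expWord_plaqWord` (weight 4), **`analyticAt_plaqFun`** (entire),
  **`norm_plaqFun_le`** (`≤ ‖τ‖(1 + e^{4‖A‖})`), LOCALITY `plaqFun_add_single` (blind to bonds off `∂p`) — for EVERY
  background with `‖U₀(b)‖, ‖U₀(b)⁻¹‖ ≤ 1` (unitary in particular).
* §2 `wilsonV Pl bd τ U₀ A := Σ_{p ∈ Pl} plaqFun τ U₀ (bd p) A`; **`norm_tail₂_locGrad_wilsonV_le`** ∕
  **`prop4Hyp_wilsonV`**: with at most `m` plaquettes through any bond, for every `R > 0`,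
  `Prop4Hyp (tail₂ (locGrad 𝒲)) (32·m·‖τ‖(1 + e^{4R})∕R³) (R∕2)` (file 1's `prop4Hyp_locGrad`); `prop4Hyp_wilsonV_one`
  (`R = 1`: `C₄ = 32·m·‖τ‖·(1 + e⁴)`, `a₃ = 1∕2`).  The constant does not see `U₀`, `#Pl`, `#Λ` — the one-grid content of
  «C₄ depends on d and L only» (on `ℤᵈ`, `m = 2(d − 1)`).
NOT HERE (said in the headlines): the `η`-scaled display (97) `C₄ε₃²η⁻³` for `|A′| < ε₃η⁻¹` (pure bookkeeping from §2 —
a crew row); the matrix∕`SU(N)` instance (`𝔸 = M_N(ℂ)`, unitary `U₀`, `τ = tr`: a crew row); the MULTI-SCALE gain of (97)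
on `Ω_j`, `j ≥ 1` (B11 (39)∕(40), [6] (1.50)∕(1.52)); the `HD`-terms and commutator terms of (80) ((85)–(89), (91)–(96):
they consume `H` = [5] Thm 3.12 = WALL (46) and `D` = `Cf` = [4] Prop. 4); the [dict] identification with END-II's
`W𝒱 V` (node O).  No estimate of Bałaban's at a live level is discharged.
-/

noncomputable section

open Metric Set NormedSpace

namespace Summit.QuantumFields.BalabanUV.T4Continuum.ShellMeasureWilsonGradientTail

open Literature.MathematicalPhysics.QuantumFieldTheory.Balaban1983to89
open B11Prop6Scheme (Prop4Hyp)
open B12AverageCorridor267 (expU val_expU val_inv_expU)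
open ShellMeasureAverageAnalytic (ExpWord)
open ShellMeasureLocalGradientTail (tail₂ locGrad sgl prop4Hyp_locGrad norm_tail₂_locGrad_le)

variable {Λ : Type*} {𝔸 : Type*} [NormedRing 𝔸] [NormedAlgebra ℂ 𝔸] [CompleteSpace 𝔸]

/-! ## §1 The plaquette word of the perturbed configuration `e^{iA}U₀` and the plaquette functional -/

/-- The LETTER of the oriented bond `(b, σ)` in the perturbed configuration `e^{iA(b)}U₀(b)`: the unit
`e^{iA(b)}U₀(b)` for `σ = true`, its inverse for `σ = false` (B11 (12)∕(24): `U₁U₀`, `U₁ = exp iηA`, at one grid `η = 1`).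
[folklore] -/
def letter (U : Λ → 𝔸ˣ) (A : Λ → 𝔸) (bσ : Λ × Bool) : 𝔸ˣ :=
  if bσ.2 then expU (Complex.I • A bσ.1) * U bσ.1 else (expU (Complex.I • A bσ.1) * U bσ.1)⁻¹

/-- The PLAQUETTE WORD `U(∂p)` of the perturbed configuration along an oriented boundary of four letters
`bd : Fin 4 → Λ × Bool`. [folklore] -/
def plaqWord (U : Λ → 𝔸ˣ) (bd : Fin 4 → Λ × Bool) (A : Λ → 𝔸) : 𝔸ˣ :=
  ((List.ofFn bd).map (letter U A)).prod

/-- The PLAQUETTE FUNCTIONAL `A ↦ τ(1 − U(∂p))` for a continuous linear «trace» `τ` (B11 (24)∕(35): `1 − Re tr U(∂p)`,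
continued to complex `A` — the «Re» is realised by pairing a boundary with its reverse, both members of the family).
[folklore] -/
def plaqFun (τ : 𝔸 →L[ℂ] ℂ) (U : Λ → 𝔸ˣ) (bd : Fin 4 → Λ × Bool) (A : Λ → 𝔸) : ℂ :=
  τ (1 - (plaqWord U bd A : 𝔸))

/-- The bonds of a boundary. [folklore] -/
def bonds [DecidableEq Λ] (bd : Fin 4 → Λ × Bool) : Finset Λ := Finset.univ.image fun i => (bd i).1

/-- LOCALITY: the plaquette functional does not see bonds off its boundary. [folklore] -/
theorem plaqFun_add_single [DecidableEq Λ] (τ : 𝔸 →L[ℂ] ℂ) (U : Λ → 𝔸ˣ) (bd : Fin 4 → Λ × Bool) (A : Λ → 𝔸)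
    {b : Λ} (hb : b ∉ bonds bd) (X : 𝔸) : plaqFun τ U bd (A + Pi.single b X) = plaqFun τ U bd A := by
  have hne : ∀ i, (bd i).1 ≠ b := fun i h => hb (Finset.mem_image.2 ⟨i, Finset.mem_univ _, h⟩)
  have hl : ∀ bσ ∈ List.ofFn bd, letter U (A + Pi.single b X) bσ = letter U A bσ := by
    intro bσ hbσ
    obtain ⟨i, rfl⟩ := List.mem_ofFn.1 hbσ
    simp only [letter, Pi.add_apply, Pi.single_apply, if_neg (hne i), add_zero]
  unfold plaqFun plaqWord
  rw [List.map_congr_left hl]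

section Word

variable [Fintype Λ] [NormOneClass 𝔸] {U : Λ → 𝔸ˣ} (hU : ∀ b, ‖(U b : 𝔸)‖ ≤ 1)
  (hU' : ∀ b, ‖(((U b)⁻¹ : 𝔸ˣ) : 𝔸)‖ ≤ 1)
include hU hU'

/-- Every letter is an `ExpWord` of weight `1` on the sup-normed bond fields (the owner's engine
`ShellMeasureAverageAnalytic.ExpWord.expFactor` at the evaluation map `A ↦ A(b)`). [folklore] -/
theorem expWord_letter (bσ : Λ × Bool) : ExpWord (fun A : Λ → 𝔸 => letter U A bσ) 1 := by
  have hℓ : ∀ A : Λ → 𝔸, ‖(ContinuousLinearMap.proj (R := ℂ) (φ := fun _ : Λ => 𝔸) bσ.1) A‖ ≤ ‖A‖ :=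
    fun A => norm_le_pi_norm A bσ.1
  have h := ExpWord.expFactor (E := Λ → 𝔸) (ContinuousLinearMap.proj (R := ℂ) (φ := fun _ : Λ => 𝔸) bσ.1) hℓ
    (hU bσ.1) (hU' bσ.1)
  unfold letter
  by_cases hσ : bσ.2
  · simp only [hσ, if_true]
    exact h
  · simp only [hσ]
    exact h.inv

/-- The plaquette word is an `ExpWord` of weight `4`. [folklore] -/
theorem expWord_plaqWord (bd : Fin 4 → Λ × Bool) : ExpWord (fun A : Λ → 𝔸 => plaqWord U bd A) 4 := by
  have h := ExpWord.listProd (E := Λ → 𝔸) (fun bσ A => letter U A bσ) (fun _ => (1 : ℝ)) (List.ofFn bd)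
    fun bσ _ => expWord_letter hU hU' bσ
  have hsum : ((List.ofFn bd).map fun _ => (1 : ℝ)).sum = 4 := by
    simp
    norm_num
  rw [hsum] at h
  exact h

/-- The plaquette functional is analytic EVERYWHERE (an entire function of the bond field). [folklore] -/
theorem analyticAt_plaqFun (τ : 𝔸 →L[ℂ] ℂ) (bd : Fin 4 → Λ × Bool) (A : Λ → 𝔸) :
    AnalyticAt ℂ (plaqFun τ U bd) A := by
  have h := (expWord_plaqWord hU hU' bd).an A
  exact (τ.analyticAt _).comp (analyticAt_const.sub h)

/-- The crude bound `‖τ(1 − U(∂p))‖ ≤ ‖τ‖·(1 + e^{4‖A‖})`. [folklore] -/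
theorem norm_plaqFun_le (τ : 𝔸 →L[ℂ] ℂ) (bd : Fin 4 → Λ × Bool) (A : Λ → 𝔸) :
    ‖plaqFun τ U bd A‖ ≤ ‖τ‖ * (1 + Real.exp (4 * ‖A‖)) := by
  have h := (expWord_plaqWord hU hU' bd).le A
  calc ‖plaqFun τ U bd A‖ ≤ ‖τ‖ * ‖(1 : 𝔸) - (plaqWord U bd A : 𝔸)‖ := τ.le_opNorm _
    _ ≤ ‖τ‖ * (1 + Real.exp (4 * ‖A‖)) := by
      refine mul_le_mul_of_nonneg_left ?_ (norm_nonneg _)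
      calc ‖(1 : 𝔸) - (plaqWord U bd A : 𝔸)‖ ≤ ‖(1 : 𝔸)‖ + ‖(plaqWord U bd A : 𝔸)‖ := norm_sub_le _ _
        _ ≤ 1 + Real.exp (4 * ‖A‖) := by rw [norm_one]; exact add_le_add le_rfl h

/-- … hence `≤ ‖τ‖·(1 + e^{4R})` on `ball 0 R`. [folklore] -/
theorem norm_plaqFun_le_of_mem_ball (τ : 𝔸 →L[ℂ] ℂ) (bd : Fin 4 → Λ × Bool) {R : ℝ} {A : Λ → 𝔸}
    (hA : A ∈ ball (0 : Λ → 𝔸) R) : ‖plaqFun τ U bd A‖ ≤ ‖τ‖ * (1 + Real.exp (4 * R)) := by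
  refine (norm_plaqFun_le hU hU' τ bd A).trans (mul_le_mul_of_nonneg_left ?_ (norm_nonneg _))
  have hR : ‖A‖ ≤ R := (mem_ball_zero_iff.1 hA).le
  exact add_le_add le_rfl (Real.exp_le_exp.2 (by linarith))

end Word

/-! ## §2 The Wilson-type action at one grid and its (98) SHAPE -/

section Action

variable [Fintype Λ] [DecidableEq Λ] [NormOneClass 𝔸] {P : Type*} (Pl : Finset P) (bd : P → Fin 4 → Λ × Bool)
  (τ : 𝔸 →L[ℂ] ℂ) (U : Λ → 𝔸ˣ)

/-- THE ONE-GRID WILSON-TYPE ACTION about the background `U₀`, as a functional of the (complexified) bond field `A`: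
`𝒲(A) = Σ_{p ∈ Pl} τ(1 − (e^{iA}U₀)(∂p))`. [folklore] -/
def wilsonV (A : Λ → 𝔸) : ℂ := ∑ p ∈ Pl, plaqFun τ U (bd p) A

/-- **B11 (90)∕(97) AT ONE GRID — the plaquette part.**  For ANY background with `‖U₀(b)‖, ‖U₀(b)⁻¹‖ ≤ 1` (e.g. unitary),
ANY finite plaquette family with at most `m` plaquettes through a bond, ANY `R > 0`: the bond-localised derivative of
the order-≥3 part of `𝒲` — `tail₂ (locGrad 𝒲)`, the 2-tail of the local gradient map — satisfies
`‖tail₂ (locGrad 𝒲) A‖_sup ≤ (32·m·‖τ‖(1 + e^{4R})∕R³)·‖A‖²_sup` on `‖A‖_sup < R∕2`.  The constant depends on the incidence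
number `m`, on `‖τ‖` and on `R` ONLY — not on the background, not on `#Pl`, not on `#Λ` ((97): «The constants a₃, C₄
depend on d and L only»; here d enters through `m = 2(d − 1)` on `ℤᵈ`).  NOT here: the multi-scale weights of (97) on
`Ω_j`, `j ≥ 1` (B11 (39)∕(40)), the `HD`-terms of (80). [folklore] -/
theorem norm_tail₂_locGrad_wilsonV_le (hU : ∀ b, ‖(U b : 𝔸)‖ ≤ 1) (hU' : ∀ b, ‖(((U b)⁻¹ : 𝔸ˣ) : 𝔸)‖ ≤ 1)
    {m : ℕ} (hm : ∀ b : Λ, (Pl.filter (fun p => b ∈ bonds (bd p))).card ≤ m) {R : ℝ} (hR : 0 < R) :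
    ∀ A ∈ ball (0 : Λ → 𝔸) (R / 2),
      ‖tail₂ (locGrad (wilsonV Pl bd τ U)) A‖ ≤ 32 * m * (‖τ‖ * (1 + Real.exp (4 * R))) / R ^ 3 * ‖A‖ ^ 2 :=
  norm_tail₂_locGrad_le Pl (fun p => plaqFun τ U (bd p)) (fun p => bonds (bd p)) hR (by positivity)
    (fun p _ A _ => analyticAt_plaqFun hU hU' τ (bd p) A)
    (fun p _ A hA => norm_plaqFun_le_of_mem_ball hU hU' τ (bd p) hA)
    (fun p _ A b hb X => plaqFun_add_single τ U (bd p) A hb X) hm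

/-- **THE (98) SHAPE OF END-II's `hW` FOR THE ONE-GRID WILSON-TYPE ACTION**:
`Prop4Hyp (tail₂ (locGrad 𝒲)) (32·m·‖τ‖(1 + e^{4R})∕R³) (R∕2)`. [folklore] -/
theorem prop4Hyp_wilsonV (hU : ∀ b, ‖(U b : 𝔸)‖ ≤ 1) (hU' : ∀ b, ‖(((U b)⁻¹ : 𝔸ˣ) : 𝔸)‖ ≤ 1)
    {m : ℕ} (hm : ∀ b : Λ, (Pl.filter (fun p => b ∈ bonds (bd p))).card ≤ m) {R : ℝ} (hR : 0 < R) :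
    Prop4Hyp (tail₂ (locGrad (wilsonV Pl bd τ U))) (32 * m * (‖τ‖ * (1 + Real.exp (4 * R))) / R ^ 3) (R / 2) :=
  prop4Hyp_locGrad Pl (fun p => plaqFun τ U (bd p)) (fun p => bonds (bd p)) hR (by positivity)
    (fun p _ A _ => analyticAt_plaqFun hU hU' τ (bd p) A)
    (fun p _ A hA => norm_plaqFun_le_of_mem_ball hU hU' τ (bd p) hA)
    (fun p _ A b hb X => plaqFun_add_single τ U (bd p) A hb X) hm

/-- The same at the fixed radius `R = 1`: `C₄ = 32·m·‖τ‖·(1 + e⁴)`, `a₃ = 1∕2` — numbers made of `m` and `‖τ‖` alone.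
[folklore] -/
theorem prop4Hyp_wilsonV_one (hU : ∀ b, ‖(U b : 𝔸)‖ ≤ 1) (hU' : ∀ b, ‖(((U b)⁻¹ : 𝔸ˣ) : 𝔸)‖ ≤ 1)
    {m : ℕ} (hm : ∀ b : Λ, (Pl.filter (fun p => b ∈ bonds (bd p))).card ≤ m) :
    Prop4Hyp (tail₂ (locGrad (wilsonV Pl bd τ U))) (32 * m * (‖τ‖ * (1 + Real.exp 4))) (1 / 2) := by
  have h := prop4Hyp_wilsonV Pl bd τ U hU hU' hm one_pos
  norm_num at h
  exact h

end Action

end Summit.QuantumFields.BalabanUV.T4Continuum.ShellMeasureWilsonGradientTail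

end
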